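import Mathlib.MeasureTheory.Measure.Haar.Unique
import Mathlib.MeasureTheory.Measure.Lebesgue.Complex
import Literature.Probability.Percolation.FlipFairKernel

/-!
# The Campbell intensity of an admissible equivariant kernel under an isometry-invariant law is a multiple of Lebesgue measure

Route `Summits/CriticalPhenomena/CardyFormulaZ2/Theses/CardyMeckeFlip`, crux `MeckeRigidity`
(item stmt-CriticalPhenomena-14826), line `registered`, stub `stub_crossingUniqueness` (helper; the
first structural fact on the kernel side of the hypotheses).

For a probability law `P` on `ℋ_ℂ` invariant under plane isometries (E2) and a kernel family `M`
with `IsAdmissibleKernel P M` (measurable, locally `P`-integrable, non-zero, …) and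
`IsIsometryEquivariant M` (`M ε (g·S) = g_* M ε S`), the **Campbell intensity measure**
`Λ_ε(A) = ∫ M ε S (A) P(dS)` — the first marginal of the Campbell measure `P(dS) M ε S(dx)` on
which clause (F) is an invariance statement — is translation invariant and finite on compact sets,
hence (uniqueness of Haar measure on `ℂ`) a finite multiple `c_ε · Leb` of Lebesgue measure
(`campbellIntensity_eq_smul_volume`, registered sub-goal), with `c_ε > 0` at the cutoff supplied by
the non-zero clause (`exists_campbellIntensity_pos`).  In particular the normalisation of any two
admissible equivariant kernels differs by a constant only, the starting point of the intended coupling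
of two flip dynamics.
-/

noncomputable section

open MeasureTheory Set Metric
open scoped ENNReal NNReal
open Literature.Probability.Percolation Literature.Probability.Percolation.QuadCrossing

namespace Summit.CriticalPhenomena.CardyFormulaZ2.Theorems.CardyMeckeFlip

/-- (E2) forces the motion `S ↦ g · S` to be `P`-a.e. measurable (else the push-forward would be
the zero measure). [folklore] -/
theorem aemeasurable_isometry_of_map_eq (P : Measure (QuadConfig (univ : Set ℂ)))
    [IsProbabilityMeasure P] (g : ℂ ≃ᵢ ℂ) (hg : Measure.map (QuadConfig.isometry g) P = P) :
    AEMeasurable (QuadConfig.isometry g) P := by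
  by_contra h
  have h0 : Measure.map (QuadConfig.isometry g) P = 0 := Measure.map_of_not_aemeasurable h
  rw [hg] at h0
  exact (IsProbabilityMeasure.ne_zero P) h0

/-- **Translation invariance of the Campbell intensity**: under (E2) and isometry-equivariance of
the kernel, `A ↦ ∫ M ε S (v + A)… ` equals `A ↦ ∫ M ε S (A) …` — precisely, the preimage of `A`
under the translation by `v` has the same intensity. [folklore] -/
theorem lintegral_kernel_preimage_add_left (P : Measure (QuadConfig (univ : Set ℂ)))
    [IsProbabilityMeasure P] (M : ℝ → QuadConfig (univ : Set ℂ) → Measure ℂ)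
    (hE2 : ∀ g : ℂ ≃ᵢ ℂ, Measure.map (QuadConfig.isometry g) P = P)
    (hM : ∀ ε : ℝ, Measurable (M ε)) (hEq : IsIsometryEquivariant M) (ε : ℝ) (v : ℂ)
    {A : Set ℂ} (hA : MeasurableSet A) :
    ∫⁻ S, M ε S ((fun x => v + x) ⁻¹' A) ∂P = ∫⁻ S, M ε S A ∂P := by
  -- the translation as a plane isometry
  let g : ℂ ≃ᵢ ℂ := IsometryEquiv.addLeft v
  have hg : ⇑g = fun x => v + x := funext fun x => IsometryEquiv.addLeft_apply v x
  -- pointwise: `M ε S (g⁻¹ A) = (g_* M ε S) A = M ε (g·S) A`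
  have hpt : ∀ S, M ε S ((fun x => v + x) ⁻¹' A) = M ε (QuadConfig.isometry g S) A := by
    intro S
    rw [hEq g ε S, Measure.map_apply g.continuous.measurable hA, hg]
  simp_rw [hpt]
  -- change of variables `S' = g · S` and (E2)
  have hmeasA : Measurable fun S : QuadConfig (univ : Set ℂ) => M ε S A :=
    (Measure.measurable_measure.1 (hM ε)) A hA
  calc ∫⁻ S, M ε (QuadConfig.isometry g S) A ∂P
      = ∫⁻ S, M ε S A ∂(Measure.map (QuadConfig.isometry g) P) :=
        (lintegral_map' hmeasA.aemeasurable (aemeasurable_isometry_of_map_eq P g (hE2 g))).symm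
    _ = ∫⁻ S, M ε S A ∂P := by rw [hE2 g]

/-- **The Campbell intensity is a multiple of Lebesgue measure** (registered sub-goal
`campbellIntensity_eq_smul_volume` of item stmt-CriticalPhenomena-14826): under (E2),
`IsAdmissibleKernel P M` and `IsIsometryEquivariant M`, for every cutoff `ε > 0` there is a finite
constant `c` with `∫ M ε S (A) P(dS) = c · Leb(A)` for every Borel `A ⊆ ℂ` (translation invariance
+ finiteness on compacts + uniqueness of Haar measure). [folklore] -/
theorem campbellIntensity_eq_smul_volume : ∀ (P : Measure (QuadConfig (Set.univ : Set ℂ))) (M : ℝ → QuadConfig (Set.univ : Set ℂ) → Measure ℂ), IsProbabilityMeasure P → (∀ g : ℂ ≃ᵢ ℂ, Measure.map (QuadConfig.isometry g) P = P) → IsAdmissibleKernel P M → IsIsometryEquivariant M → ∀ ε : ℝ, 0 < ε → ∃ c : NNReal, ∀ A : Set ℂ, MeasurableSet A → ∫⁻ S, M ε S A ∂P = c * volume A := by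
  intro P M hP hE2 hADM hEq ε hε
  -- the intensity measure `Λ = P.bind (M ε)`
  set Λ : Measure ℂ := P.bind (M ε) with hΛ
  have hΛapply : ∀ A : Set ℂ, MeasurableSet A → Λ A = ∫⁻ S, M ε S A ∂P := fun A hA =>
    Measure.bind_apply hA (hADM.measurable ε).aemeasurable
  -- translation invariance
  haveI : Λ.IsAddLeftInvariant := by
    refine ⟨fun v => ?_⟩
    ext A hA
    rw [Measure.map_apply (measurable_const_add v) hA, hΛapply A hA,
      hΛapply _ (measurable_const_add v hA)]
    exact lintegral_kernel_preimage_add_left P M hE2 hADM.measurable hEq ε v hA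
  -- finiteness on compact sets, from local `P`-integrability
  haveI : IsFiniteMeasureOnCompacts Λ := by
    refine ⟨fun K hK => ?_⟩
    obtain ⟨r, hr⟩ := hK.isBounded.subset_closedBall (0 : ℂ)
    calc Λ K ≤ Λ (closedBall 0 r) := measure_mono hr
      _ = ∫⁻ S, M ε S (closedBall 0 r) ∂P := hΛapply _ measurableSet_closedBall
      _ < ⊤ := hADM.lintegral_closedBall_lt_top ε hε r
  -- uniqueness of Haar measure on `ℂ`
  have huniq : Λ = Λ.addHaarScalarFactor volume • (volume : Measure ℂ) :=
    Measure.isAddLeftInvariant_eq_smul Λ volume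
  refine ⟨Λ.addHaarScalarFactor volume, fun A hA => ?_⟩
  rw [← hΛapply A hA]
  conv_lhs => rw [huniq]
  rw [Measure.coe_nnreal_smul_apply]

/-- **Positive intensity at the non-degenerate cutoff**: at the cutoff `ε₀ > 0` supplied by the
non-zero clause of (ADM), the constant is positive: `∫ M ε₀ S (A) P(dS) = c · Leb(A)` with `c > 0`.
[folklore] -/
theorem exists_campbellIntensity_pos (P : Measure (QuadConfig (univ : Set ℂ))) [IsProbabilityMeasure P]
    (M : ℝ → QuadConfig (univ : Set ℂ) → Measure ℂ)
    (hE2 : ∀ g : ℂ ≃ᵢ ℂ, Measure.map (QuadConfig.isometry g) P = P)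
    (hADM : IsAdmissibleKernel P M) (hEq : IsIsometryEquivariant M) :
    ∃ ε : ℝ, 0 < ε ∧ ∃ c : NNReal, 0 < c ∧
      ∀ A : Set ℂ, MeasurableSet A → ∫⁻ S, M ε S A ∂P = c * volume A := by
  obtain ⟨ε, hε, hpos⟩ := hADM.exists_lintegral_ball_pos
  obtain ⟨c, hc⟩ := campbellIntensity_eq_smul_volume P M inferInstance hE2 hADM hEq ε hε
  refine ⟨ε, hε, c, ?_, hc⟩
  rw [hc _ measurableSet_ball] at hpos
  by_contra h0
  have : c = 0 := le_antisymm (not_lt.1 h0) c.2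
  simp [this] at hpos

end Summit.CriticalPhenomena.CardyFormulaZ2.Theorems.CardyMeckeFlip

end
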